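import Summits.BirchSwinnertonDyer.BirchSwinnertonDyer.Theorems.UniversalToricDescentResidualSelmerExact
import Summits.BirchSwinnertonDyer.BirchSwinnertonDyer.Theorems.UniversalToricDescentAcDualMuZeroCriterion
import Summits.BirchSwinnertonDyer.Rank1Residual.Additive.CongruentPartnerBudgetSchemaHolds
import HarnessLib

/-!
# Route UniversalToricDescent — the `Σ`-IMPRIMITIVE λ-INVARIANTS of `p`-congruent curves AGREE
# (port-grade algebraic half of child 21845 `InvariantsTransportModThreeT`, PRICING-20399-ALG-HALF §3(c),
# modulo «no finite `Λ`-submodule» (N1) on both sides)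

Lead prover bsd-wall-utd-p1 g6 (`--supports stmt-BirchSwinnertonDyer-20399`). Greenberg–Vatsal's
transport of the λ-invariant (GV00 Thm. (1.4), proof of Prop. (2.8)): for `E₁[p] ≅ E₂[p]`,
`λ(X^Σ(E₁)) = dim_{𝔽_p} Sel^Σ(E₁)[p] = dim R^Σ(E₁[p]) = dim R^Σ(E₂[p]) = dim Sel^Σ(E₂)[p] = λ(X^Σ(E₂))`,
the outer equalities because `X^Σ` is `ℤ_p`-free of rank `λ` when it is `Λ`-torsion with `μ = 0` and
without non-zero finite `Λ`-submodule. Here, for Castella's anticyclotomic Selmer groups over ANY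
`ℤ_p`-extension of a number field `K` and `X = X_ac^Σ := Hom(Sel_𝔭^Σ(K_∞, E[p^∞]), ℚ/ℤ)` (`AcSelmer.XAc`):
* §1 `pow_lambdaInvariant_eq_natCard_selmerAc_pTorsion`: `p^{λ(X_ac^Σ(E))} = #Sel_𝔭^Σ(K_∞, E[p^∞])[p]` for
  `X` torsion, `μ = 0`, no finite submodule — the tree's Mathlib-only (L1)
  `Additive.card_quotient_eq_pow_lambdaInvariant_holds` (`#(X/𝔭X) = p^λ`) and Pontryagin counting
  `Iwasawa.natCard_modN_characterModule_eq` (`#(Hom(B, ℚ/ℤ)/p) = #B[p]`), `X_ac^Σ` being LITERALLY the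
  character module of `Sel_𝔭^Σ`;
* §2 `lambdaInvariant_eq_of_torsionIso`: with the EXACT residual comparison
  `UniversalToricDescentResidualSelmerExact.natCard_selmerAc_pTorsion_eq_of_torsionIso` (under (L)
  `E₁(K_{∞,𝔭})[p] = 0` at the strict place, `p` odd, `Σ ⊇` bad places prime to `p`):
  `λ(X_ac^Σ(E₁)) = λ(X_ac^Σ(E₂))`; `isTorsion_and_muInvariant_eq_zero_of_torsionIso`: torsion and `μ = 0`
  pass from `E₁` to `E₂` in the same breath (`#Sel(E₂)[p] = p^{λ₁} ≠ 0` ⟹ finite ⟹ the Λ-side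
  `UniversalToricDescentAcDualMuZero.isTorsion_of_finite_pTorsion` / `muInvariant_eq_zero_of_finite_pTorsion`);
* §3 the route's instance `W, W′/ℚ`, `ModPCongruent W′ W p`, base-changed to `K`.

HONEST STATUS: helper theorems; the hypotheses «no non-zero finite `Λ`-submodule» for BOTH curves (N1 of
20399: Greenberg Prop. 4.14/4.15 via the route's Poitou–Tate leaves) and (L) are NOT discharged here; the
passage `Σ → ∅` (local λ-terms) and the analytic half of 21845 remain. THEOREMS ONLY; no definition, no
named fact, no `sorry`. BSD is not advanced by this file.
References: [GreenbergVatsal2000] Thm. (1.4), §2 Prop. (2.8) (pp. 26–27); [Washington1997] §13.2;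
[GreenbergLNM1716] §1 p. 60.
-/

set_option autoImplicit false
-- `…BirchSwinnertonDyer.BirchSwinnertonDyer.Theorems…` is the problem's mandated namespace (D-0017).
set_option linter.dupNamespace false

noncomputable section

open scoped Classical AddSubgroup

namespace Summit.BirchSwinnertonDyer.BirchSwinnertonDyer.Theorems.UniversalToricDescentLambdaTransport

open NumberField IsDedekindDomain Field
open Literature.NumberTheory.EllipticCurves Literature.NumberTheory.EllipticCurves.IwasawaAlgebra
  Literature.NumberTheory.EllipticCurves.GreenbergSelmer
  Literature.NumberTheory.GaloisRepresentations WeierstrassCurve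
  Summit.BirchSwinnertonDyer.Rank1Residual.X11b Summit.BirchSwinnertonDyer.Rank1Residual.X11b.AcSelmer
  Summit.BirchSwinnertonDyer.Rank1Residual.Iwasawa Summit.BirchSwinnertonDyer.Rank1Residual.Additive
  Summit.BirchSwinnertonDyer.BirchSwinnertonDyer.Theorems.UniversalToricDescentAcDualMuZero
  Summit.BirchSwinnertonDyer.BirchSwinnertonDyer.Theorems.UniversalToricDescentResidualSelmerTransfer
  Summit.BirchSwinnertonDyer.BirchSwinnertonDyer.Theorems.UniversalToricDescentResidualSelmerExact

variable {K : Type} [Field K] [NumberField K]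

/-! ### §1 `p^{λ(X_ac^Σ)} = #Sel_𝔭^Σ(K_∞, E[p^∞])[p]` -/

section Count

variable (W : WeierstrassCurve K) [W.IsElliptic] (p : ℕ) [Fact p.Prime] (κ : ZpExtension K p)
  (𝔭 : HeightOneSpectrum (𝓞 K)) (S : Set (HeightOneSpectrum (𝓞 K)))
  (γ : absoluteGaloisGroup K) [Fact (κ.IsTopGenerator γ)]

/-- **`p^{λ(X)} = #Sel_𝔭^Σ(K_∞, E[p^∞])[p]` for `X = X_ac^Σ(E[p^∞])` torsion with `μ = 0` and no non-zero
finite `Λ`-submodule** (finite `Σ`): `#(X/𝔭X) = p^{λ(X)}` ((L1), `X` is then `ℤ_p`-free of rank `λ`) and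
`#(X/pX) = #Sel[p]` (Pontryagin: `X` is the character module of `Sel`). (Greenberg–Vatsal p. 27:
"`λ_E` is the `ℤ_p`-rank … equal to `dim Sel[p]` since there is no finite submodule".)
[cite: GreenbergVatsal2000, §2 Prop. (2.8) (proof, p. 27)] [cite: Washington1997, §13.2] -/
theorem pow_lambdaInvariant_eq_natCard_selmerAc_pTorsion (hS : S.Finite)
    (hT : Module.IsTorsion (IwasawaAlgebra p) (XAc W p κ 𝔭 S γ))
    (hμ : muInvariant p (XAc W p κ 𝔭 S γ) = 0)
    (hnf : ∀ N : Submodule (IwasawaAlgebra p) (XAc W p κ 𝔭 S γ), Finite N → N = ⊥) :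
    p ^ lambdaInvariant p (XAc W p κ 𝔭 S γ) = Nat.card {s : selmerAc W p κ 𝔭 S // p • s = 0} := by
  haveI := XAc.module_finite κ 𝔭 S γ hS (W := W)
  rw [← card_quotient_eq_pow_lambdaInvariant_holds p (XAc W p κ 𝔭 S γ) hT hμ hnf,
    natCard_quotient_augIdealP_smul_top_eq_natCard_modN p,
    show Nat.card (ModN (XAc W p κ 𝔭 S γ) p) =
      Nat.card (ModN (CharacterModule (selmerAc W p κ 𝔭 S)) p) from rfl,
    natCard_modN_characterModule_eq p]
  exact Nat.card_congr (Equiv.subtypeEquivRight fun s ↦ AddSubgroup.torsionBy.nsmul_iff)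

/-- **Conversely-flavoured reading: under the same hypotheses `Sel_𝔭^Σ(K_∞, E[p^∞])[p]` is finite of
order `p^{λ(X)}`** (`Nat.card ≠ 0`). [cite: GreenbergVatsal2000, §2 Prop. (2.8) (proof, p. 27)] -/
theorem finite_selmerAc_pTorsion_of_noFiniteSubmodule (hS : S.Finite)
    (hT : Module.IsTorsion (IwasawaAlgebra p) (XAc W p κ 𝔭 S γ))
    (hμ : muInvariant p (XAc W p κ 𝔭 S γ) = 0)
    (hnf : ∀ N : Submodule (IwasawaAlgebra p) (XAc W p κ 𝔭 S γ), Finite N → N = ⊥) :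
    Finite {s : selmerAc W p κ 𝔭 S // p • s = 0} := by
  apply Nat.finite_of_card_ne_zero
  rw [← pow_lambdaInvariant_eq_natCard_selmerAc_pTorsion W p κ 𝔭 S γ hS hT hμ hnf]
  exact pow_ne_zero _ (Fact.out : p.Prime).ne_zero

end Count

/-! ### §2 Two `p`-congruent curves over `K`: `λ(X_ac^Σ(E₁)) = λ(X_ac^Σ(E₂))` -/

section TwoCurves

variable {p : ℕ} [Fact p.Prime] (κ : ZpExtension K p) (γ : absoluteGaloisGroup K)
  [Fact (κ.IsTopGenerator γ)]

/-- **Torsion and `μ = 0` pass along `E₁[p] ≅ E₂[p]` in the exact setting.** If `X_ac^Σ(E₁)` is torsion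
with `μ = 0` and no finite submodule, then `#Sel^Σ(E₂)[p] = #Sel^Σ(E₁)[p] = p^{λ₁} ≠ 0`
(`natCard_selmerAc_pTorsion_eq_of_torsionIso`, under (L)), so `Sel^Σ(E₂)[p]` is finite and `X_ac^Σ(E₂)` is
torsion with `μ = 0` (Λ-side criterion of `UniversalToricDescentAcDualMuZeroCriterion`).
[cite: GreenbergVatsal2000, §2 Prop. (2.8)] -/
theorem isTorsion_and_muInvariant_eq_zero_of_torsionIso (W₁ W₂ : WeierstrassCurve K) [W₁.IsElliptic]
    [W₂.IsElliptic] (hp : p ≠ 2) {𝔭 : HeightOneSpectrum (𝓞 K)} (h𝔭 : ((p : ℕ) : 𝓞 K) ∈ 𝔭.asIdeal)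
    {S : Set (HeightOneSpectrum (𝓞 K))} (hS : S.Finite)
    (hS₁ : ∀ v : HeightOneSpectrum (𝓞 K), v ∉ S → ((p : ℕ) : 𝓞 K) ∉ v.asIdeal → W₁.HasGoodReductionAt v)
    (hS₂ : ∀ v : HeightOneSpectrum (𝓞 K), v ∉ S → ((p : ℕ) : 𝓞 K) ∉ v.asIdeal → W₂.HasGoodReductionAt v)
    (e : W₁.geomTorsion (p : ℤ) ≃+ W₂.geomTorsion (p : ℤ))
    (he : ∀ (σ : absoluteGaloisGroup K) (P : W₁.geomTorsion (p : ℤ)), e (σ • P) = σ • e P)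
    (hL : ∀ m : W₁.geomPrimaryTorsion p,
      (∀ σ ∈ κ.kerSubgroup ⊓ decomp 𝔭, σ • m = m) → p • m = 0 → m = 0)
    (hT₁ : Module.IsTorsion (IwasawaAlgebra p) (XAc W₁ p κ 𝔭 S γ))
    (hμ₁ : muInvariant p (XAc W₁ p κ 𝔭 S γ) = 0)
    (hnf₁ : ∀ N : Submodule (IwasawaAlgebra p) (XAc W₁ p κ 𝔭 S γ), Finite N → N = ⊥) :
    Module.IsTorsion (IwasawaAlgebra p) (XAc W₂ p κ 𝔭 S γ) ∧ muInvariant p (XAc W₂ p κ 𝔭 S γ) = 0 := by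
  have hfin₁ := finite_selmerAc_pTorsion_of_noFiniteSubmodule W₁ p κ 𝔭 S γ hS hT₁ hμ₁ hnf₁
  have hcard := natCard_selmerAc_pTorsion_eq_of_torsionIso κ W₁ W₂ hp h𝔭 hS₁ hS₂ e he hL
  have h0 : Nat.card {s : selmerAc W₁ p κ 𝔭 S // p • s = 0} ≠ 0 := by
    haveI := hfin₁
    haveI : Nonempty {s : selmerAc W₁ p κ 𝔭 S // p • s = 0} := ⟨⟨0, smul_zero p⟩⟩
    exact Nat.card_pos.ne'
  have hfin₂ : Finite {s : selmerAc W₂ p κ 𝔭 S // p • s = 0} := by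
    apply Nat.finite_of_card_ne_zero
    rw [← hcard]
    exact h0
  have hfin₂' : Set.Finite {s : selmerAc W₂ p κ 𝔭 S | p • s = 0} := Set.finite_coe_iff.mp hfin₂
  exact ⟨isTorsion_of_finite_pTorsion W₂ p κ 𝔭 S γ hS hfin₂',
    muInvariant_eq_zero_of_finite_pTorsion W₂ p κ 𝔭 S γ hS hfin₂'⟩

/-- **Greenberg–Vatsal's λ-transport for Castella's `Σ`-imprimitive anticyclotomic dual Selmer groups.**
For elliptic curves `E₁, E₂/K` with a `Γ_K`-equivariant `E₁[p] ≅ E₂[p]`, `p` odd, `𝔭 ∋ p`, a finite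
`Σ ∌ 𝔭` containing the bad places of both curves prime to `p`, ANY `ℤ_p`-extension `K_∞` with
(L) `E₁(K_{∞,𝔭})[p] = 0`, topological generator `γ`: if `X_ac^Σ(E₁)` is `Λ`-torsion with `μ = 0` and
NEITHER `X_ac^Σ(E_i)` has a non-zero finite `Λ`-submodule, then
`λ(X_ac^Σ(E₁)) = λ(X_ac^Σ(E₂))` — `p^{λ₁} = #Sel^Σ(E₁)[p] = #Sel^Σ(E₂)[p] = p^{λ₂}`.
[cite: GreenbergVatsal2000, Thm. (1.4) and §2 Prop. (2.8) (proof, pp. 26–27)] -/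
theorem lambdaInvariant_eq_of_torsionIso (W₁ W₂ : WeierstrassCurve K) [W₁.IsElliptic] [W₂.IsElliptic]
    (hp : p ≠ 2) {𝔭 : HeightOneSpectrum (𝓞 K)} (h𝔭 : ((p : ℕ) : 𝓞 K) ∈ 𝔭.asIdeal)
    {S : Set (HeightOneSpectrum (𝓞 K))} (hS : S.Finite)
    (hS₁ : ∀ v : HeightOneSpectrum (𝓞 K), v ∉ S → ((p : ℕ) : 𝓞 K) ∉ v.asIdeal → W₁.HasGoodReductionAt v)
    (hS₂ : ∀ v : HeightOneSpectrum (𝓞 K), v ∉ S → ((p : ℕ) : 𝓞 K) ∉ v.asIdeal → W₂.HasGoodReductionAt v)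
    (e : W₁.geomTorsion (p : ℤ) ≃+ W₂.geomTorsion (p : ℤ))
    (he : ∀ (σ : absoluteGaloisGroup K) (P : W₁.geomTorsion (p : ℤ)), e (σ • P) = σ • e P)
    (hL : ∀ m : W₁.geomPrimaryTorsion p,
      (∀ σ ∈ κ.kerSubgroup ⊓ decomp 𝔭, σ • m = m) → p • m = 0 → m = 0)
    (hT₁ : Module.IsTorsion (IwasawaAlgebra p) (XAc W₁ p κ 𝔭 S γ))
    (hμ₁ : muInvariant p (XAc W₁ p κ 𝔭 S γ) = 0)
    (hnf₁ : ∀ N : Submodule (IwasawaAlgebra p) (XAc W₁ p κ 𝔭 S γ), Finite N → N = ⊥)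
    (hnf₂ : ∀ N : Submodule (IwasawaAlgebra p) (XAc W₂ p κ 𝔭 S γ), Finite N → N = ⊥) :
    lambdaInvariant p (XAc W₁ p κ 𝔭 S γ) = lambdaInvariant p (XAc W₂ p κ 𝔭 S γ) := by
  obtain ⟨hT₂, hμ₂⟩ := isTorsion_and_muInvariant_eq_zero_of_torsionIso κ γ W₁ W₂ hp h𝔭 hS hS₁ hS₂ e he
    hL hT₁ hμ₁ hnf₁
  apply Nat.pow_right_injective (Fact.out : p.Prime).two_le
  simp only
  rw [pow_lambdaInvariant_eq_natCard_selmerAc_pTorsion W₁ p κ 𝔭 S γ hS hT₁ hμ₁ hnf₁,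
    pow_lambdaInvariant_eq_natCard_selmerAc_pTorsion W₂ p κ 𝔭 S γ hS hT₂ hμ₂ hnf₂]
  exact natCard_selmerAc_pTorsion_eq_of_torsionIso κ W₁ W₂ hp h𝔭 hS₁ hS₂ e he hL

end TwoCurves

/-! ### §3 The route's instance: `W, W′` over `ℚ`, `ModPCongruent W′ W p`, base-changed to `K` -/

section Route

variable {p : ℕ} [Fact p.Prime]

/-- **λ-, μ- and torsion-transport for the route's twin at the `Σ`-imprimitive level.** For `W, W′/ℚ`
with `W′[p] ≅ W[p]` (`ModPCongruent W′ W p`), a number field `K`, ANY `ℤ_p`-extension `κ` of `K` with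
topological generator `γ`, `p` odd, `𝔭 ∋ p`, a finite `Σ ∌ 𝔭` containing the bad places of `W_K`, `W′_K`
prime to `p`, (L) `W′(K_{∞,𝔭})[p] = 0`, and no non-zero finite `Λ`-submodule in either `X_ac^Σ`: if the
TWIN's `X_ac^Σ(W′_K)` is torsion with `μ = 0` then so is `X_ac^Σ(W_K)`, and
`λ(X_ac^Σ(W_K)) = λ(X_ac^Σ(W′_K))`. In the crux's binders (`p = 3`, Heegner field, anticyclotomic `κ`,
strict place `𝔭′`) this is the `Σ`-imprimitive algebraic λ-half of 21845 modulo (N1) and (L).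
[cite: GreenbergVatsal2000, Thm. (1.4) and §2 Prop. (2.8)] -/
theorem lambdaInvariant_baseChange_eq_of_modPCongruent (W W' : WeierstrassCurve ℚ) [W.IsElliptic]
    [W'.IsElliptic] (K : Type) [Field K] [NumberField K] (κ : ZpExtension K p)
    (γ : absoluteGaloisGroup K) [Fact (κ.IsTopGenerator γ)]
    (hp : p ≠ 2) {𝔭 : HeightOneSpectrum (𝓞 K)} (h𝔭 : ((p : ℕ) : 𝓞 K) ∈ 𝔭.asIdeal)
    {S : Set (HeightOneSpectrum (𝓞 K))} (hS : S.Finite)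
    (hSW : ∀ v : HeightOneSpectrum (𝓞 K), v ∉ S → ((p : ℕ) : 𝓞 K) ∉ v.asIdeal →
      (W.baseChange K).HasGoodReductionAt v)
    (hSW' : ∀ v : HeightOneSpectrum (𝓞 K), v ∉ S → ((p : ℕ) : 𝓞 K) ∉ v.asIdeal →
      (W'.baseChange K).HasGoodReductionAt v)
    (hcong : Summit.BirchSwinnertonDyer.Rank1Residual.O6.ModPCongruent W' W p)
    (hL : ∀ m : (W'.baseChange K).geomPrimaryTorsion p,
      (∀ σ ∈ κ.kerSubgroup ⊓ decomp 𝔭, σ • m = m) → p • m = 0 → m = 0)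
    (hT' : Module.IsTorsion (IwasawaAlgebra p) (XAc (W'.baseChange K) p κ 𝔭 S γ))
    (hμ' : muInvariant p (XAc (W'.baseChange K) p κ 𝔭 S γ) = 0)
    (hnf' : ∀ N : Submodule (IwasawaAlgebra p) (XAc (W'.baseChange K) p κ 𝔭 S γ), Finite N → N = ⊥)
    (hnf : ∀ N : Submodule (IwasawaAlgebra p) (XAc (W.baseChange K) p κ 𝔭 S γ), Finite N → N = ⊥) :
    Module.IsTorsion (IwasawaAlgebra p) (XAc (W.baseChange K) p κ 𝔭 S γ) ∧
      muInvariant p (XAc (W.baseChange K) p κ 𝔭 S γ) = 0 ∧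
      lambdaInvariant p (XAc (W.baseChange K) p κ 𝔭 S γ) =
        lambdaInvariant p (XAc (W'.baseChange K) p κ 𝔭 S γ) := by
  obtain ⟨e, he⟩ := exists_torsionIso_baseChange_of_modPCongruent (K := K) W W' hcong
  obtain ⟨hT, hμ⟩ := isTorsion_and_muInvariant_eq_zero_of_torsionIso κ γ (W'.baseChange K)
    (W.baseChange K) hp h𝔭 hS hSW' hSW e he hL hT' hμ' hnf'
  exact ⟨hT, hμ, (lambdaInvariant_eq_of_torsionIso κ γ (W'.baseChange K) (W.baseChange K) hp h𝔭 hS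
    hSW' hSW e he hL hT' hμ' hnf' hnf).symm⟩

end Route

end Summit.BirchSwinnertonDyer.BirchSwinnertonDyer.Theorems.UniversalToricDescentLambdaTransport

end
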